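import Summits.ResolutionOfSingularities.ResolutionOfSingularities.Theorems.MaxContactCutRiderCut
import HarnessLib

/-!
# AbsoluteRider — decomp-res node «AbsoluteRider» (lens-4 g20, critic row 132)

Content VERBATIM from the decomp-res lens-4 g20 file `HOME/decomp-res-lens-4/g20/AbsoluteRider.lean` (sha256
d859489ca280dd37, 4114 l; HOME = run/shared/lean/pub/
decomp-res), of which l. 178–3705 are the g19 RiderCut body ALREADY in the tree (`Theorems/HugValuationCut*`,
`MarkingBudget*`, `WeightDescent*`, `FactorContact*`,
`CouplingCut*`, `RiderCutClasses` / `RiderCutKernels` / `MaxContactCutRiderCut`) and are NOT landed a second time;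
the NEW content §38–§42 (l. 3707–4113) lands as
three files: `AbsoluteRider` (§38–§40, in the Theses cone), `AbsoluteRiderHasse` (§41, cone-free kernel
instance), `AbsoluteRiderLucas` (§42, arithmetic).
Critic: CRITIC-LEDGER row 132 (CLEARED 2026-08-30T18:49:46Z, DECIDED-MOD-PORT +1: the impure principal column
(L,P,¬pure) of 32260 over EVERY ground field is
EMPTY modulo the costume port `AbsRiderPort` (+ `CouplingPort` + lower weights) · MAP +1: §41/§42 kernels).
Landed by decomp-res writer g7.

Tree file 1/3 of the node, IN the Theses cone (BY-NAME wiring to the MaxContactCut items): §38 the ABSOLUTE rider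
port `AbsRiderPort n` (= g19 `RiderPort n` with the
`[PerfectField k]` binder removed; COSTUME, counted 0), `ImperfectRiderPort`, the em split `absRiderPort_iff` /
`absRiderPortAll_iff`; §39 kernels at weight `n`
(`ImpurePrincipalTowersTerminate`, `NoImpurePrincipalTowers`, `incommensurableImpure_of_absPorts`,
`impurePrincipal_of_absPorts`, `…WildDrifting…_of_absPorts`,
the sharp `incommensurableWildDriftingImperfect_of_imperfectPort`, `inLocus_iff_residuals_of_lower_g20`,
`singularSurface_iff_g20`, `ftt_step_of_g20`); §40 all
weights by strong induction: `forcedTowersTerminate_of_g20`, root 30253 `noForcedTowers_of_g20`, host 32260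
`noSingularSurfaceHuggingTowers_of_g20`, up-links,
port-free necessities, EXACT `noForcedTowers_iff_g20` / `noSingularSurfaceHuggingTowers_iff_g20` / `…_iff_g20'`.
PROVED, 0 sorry.  Imports the landed
`MaxContactCutRiderCut` (g19 wiring, which carries `RiderCutKernels` and `MaxContactCutCouplingCut`).  Supports 32260.

[WRITER NOTE (decomp-res writer g7): as for every lens-4 node since g6, the content lives in the ONE namespace
`…Theorems.HugValuationCut` (the lens wrote
`…Theorems.AbsoluteRider`; only the namespace line differs) so that `RiderPort`, `CouplingPort`, `HugChain.…`
resolve against the landed units verbatim; global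
`set_option` lines dropped; critic hygiene h2 applied in docstrings only («Cor 4.5» ↦ «Rem 4.5», arXiv
numbering of Abad 2019).  No new route aside: the node
decides a column, it does not re-locate the residual (host 32260 / root 30253 / up-links BY NAME in `AbsoluteRider`).]

(Sources: Abad2019 (doi:10.1016/j.jalgebra.2018.12.021 = arXiv:1801.08458) Thm 4.11, Prop 4.4, Rem 4.5, Lemma 6.2,
Prop 6.3; CossartPiltant2019 Prop 2.50(3); CossartJannsenSaito2020 Key Thm 6.40; Giraud1975; EGA IV₄ 16.11.2; Stacks 00TV.)
-/

noncomputable section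

open CategoryTheory AlgebraicGeometry IsLocalRing
open Literature.AlgebraicGeometry.Resolution
open Summit.ResolutionOfSingularities.ResolutionOfSingularities.Theses
open Summit.ResolutionOfSingularities.ResolutionOfSingularities.Theorems
open WeakOrderReduction ForcedTowerClasses DivergentTowerClasses MonomialTowerClasses
open HugDimensionClasses HugDimensionKernels SurfaceShadowClasses SurfaceShadowKernels
open ContactShadowClasses (NoTowerImperfect)
open ContactShadowKernels (noTowerImperfect_of_noTower noTowerImperfect_mono noTower_iff_columns)
open NearPointCut (SingularClass singularSurface_iff_noTower)
open AbsoluteContactClasses (IsAbsContactAt)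

namespace Summit.ResolutionOfSingularities.ResolutionOfSingularities.Theorems.HugValuationCut

/-! ## §38 (g20 · NEW) The ABSOLUTE rider port — `RiderPort` with the perfectness binder REMOVED (every ground
field).  Its law
(R3) is delivered by `𝔽_p`-ABSOLUTE Hasse–Schmidt operators dual to an ABSOLUTE `p`-BASIS adapted to the
regular parameters of the
marked point (Abad 2019 Thm 4.11 · Prop 4.4 · Rem 4.5 · Lemma 6.2 · Prop 6.3; tree instance
`exists_absHasseSystem` of §41 over every
ground field essentially of finite type over `𝔽_p`); (R-pre), (R0)–(R2) were field-free already (Giraud's shift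
law is the tree theorem
over ANY base ring `k`, used at `k := ℤ`).  Complete paper proof (R3ᵃᵇˢ) in the module docstring. -/

/-- **PORT `AbsRiderPort n` — THE RIDER CENSUS EXISTS over EVERY ground field** (COSTUME = a typed conjunction of
printed facts with
a re-walkable paper proof, module docstring (R-pre)(R0)–(R2) [g19, field-free] + (R3ᵃᵇˢ) [NEW]): for an
infinite forced tower of the
singular class over ANY field of characteristic `p`, in-locus, and an in-locus PRINCIPAL IMPURE shadow `S`, the four census laws
(R1a) `rider_of_hug`, (R1b) `rider_tail`, (R2) `hug_of_rider`, (R3) `descent` hold.  Sources at the page: riding (R1c) = tree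
`IsBlowup.exists_isDiffOpLE_stalk_shift` at `k := ℤ` [BravoGarciaEscamillaVillamayor2012, Lemma 4.6 p.15] + non-increase of
hypersurface multiplicity under point blow-up [herrmann1988 = Herrmann–Ikeda–Orbanz, (31.2), p.181] + tree
`IsDiffOpLE.apply_mem_pow_sub`;
(R2) UFD + König; (R3ᵃᵇˢ) absolute `p`-basis `𝔅₀ ⊔ {u₁,u₂,u₃}` of `𝒪_{X_j,x_j}` for ANY r.s.p.
`u` [Abad 2019 = arXiv:1801.08458, Thm 4.11
p.10, Prop 4.4 p.8, Rem 4.5 p.9], absolute operators `D^[𝔅;β] ∈ Diff^{|β|}_{𝔽_p}` with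
`D^[𝔅;β](𝔅^α) = C(α,β) 𝔅^{α−β}` [ibid. Prop 6.3
p.13], `𝒪^{p^e}`-linearity of operators of order `< p^e` [ibid. Lemma 6.2 p.13 after Giraud], order formula from
`p^e`-independence of
the residues of `𝔅₀` [ibid. p.9; Cossart–Piltant 2019 J. Algebra 529 Prop 2.50(3) p.315], Lucas.  Its kernel consequences
(`RiderCensus.riderLaw`, `RiderCensus.exists_commensurable_companion`) are PROVED port-free (§32, inherited). -/
def AbsRiderPort (n : ℕ) : Prop :=
  ∀ p : ℕ, p.Prime → ∀ (k : Type) [Field k] [CharP k p] (T : ForcedTower) (g : T.St 0 ⟶ Spec (.of k)),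
    IsBase (T.St 0) g → IsDatum n (T.D 0) → (T.D 0).boundary = [] → SingularClass T →
      ∀ S : HugShadow T, S.InLocus → S.Principal → ¬ S.Pure n → RiderCensus p n S

/-- the absolute port over all weights. -/
def AbsRiderPortAll : Prop := ∀ n : ℕ, 1 ≤ n → AbsRiderPort n

/-- **the IMPERFECT HALF of the absolute port** — exactly what g19's located residual consumes
(`…_of_imperfectPort`): the rider
census over IMPERFECT ground fields. -/
def ImperfectRiderPort (n : ℕ) : Prop :=
  ∀ p : ℕ, p.Prime → ∀ (k : Type) [Field k] [CharP k p], ¬ PerfectField k → ∀ (T : ForcedTower) (g : T.St 0 ⟶ Spec (.of k)),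
    IsBase (T.St 0) g → IsDatum n (T.D 0) → (T.D 0).boundary = [] → SingularClass T →
      ∀ S : HugShadow T, S.InLocus → S.Principal → ¬ S.Pure n → RiderCensus p n S

/-- the imperfect half over all weights. -/
def ImperfectRiderPortAll : Prop := ∀ n : ℕ, 1 ≤ n → ImperfectRiderPort n

/-- the absolute port contains g19's perfect port. [folklore] -/
theorem riderPort_of_abs {n : ℕ} (h : AbsRiderPort n) : RiderPort n :=
  fun p hp k _ _ _ T g hB hD hE hS S hL hP hnp => h p hp k T g hB hD hE hS S hL hP hnp

/-- the absolute port contains its imperfect half. [folklore] -/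
theorem imperfectRiderPort_of_abs {n : ℕ} (h : AbsRiderPort n) : ImperfectRiderPort n :=
  fun p hp k _ _ _ T g hB hD hE hS S hL hP hnp => h p hp k T g hB hD hE hS S hL hP hnp

/-- **EXACT, pure logic: the absolute port is g19's perfect port AND its imperfect half** (excluded middle on
`PerfectField k`). [folklore] -/
theorem absRiderPort_iff {n : ℕ} : AbsRiderPort n ↔ RiderPort n ∧ ImperfectRiderPort n := by
  refine ⟨fun h => ⟨riderPort_of_abs h, imperfectRiderPort_of_abs h⟩, ?_⟩
  rintro ⟨h₁, h₂⟩ p hp k _ _ T g hB hD hE hS S hL hP hnp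
  by_cases hk : PerfectField k
  · haveI := hk
    exact h₁ p hp k T g hB hD hE hS S hL hP hnp
  · exact h₂ p hp k hk T g hB hD hE hS S hL hP hnp

/-- over all weights. [folklore] -/
theorem riderPortAll_of_abs (h : AbsRiderPortAll) : RiderPortAll := fun n hn => riderPort_of_abs (h n hn)

/-- over all weights. [folklore] -/
theorem absRiderPortAll_iff : AbsRiderPortAll ↔ RiderPortAll ∧ ImperfectRiderPortAll :=
  ⟨fun h => ⟨fun n hn => (absRiderPort_iff.mp (h n hn)).1, fun n hn => (absRiderPort_iff.mp (h n hn)).2⟩,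
    fun h n hn => absRiderPort_iff.mpr ⟨h.1 n hn, h.2 n hn⟩⟩

/-! ## §39 (g20 · NEW) Kernels at weight `n`: the WHOLE impure principal column — over EVERY ground field — is
EMPTY modulo
`AbsRiderPort`, `CouplingPort` and the lower weights; g19's located residual (L,P,drift,wild,incomm · IMPERFECT k)
is DECIDED-MOD-PORT
(indeed modulo the IMPERFECT HALF of the port alone); the in-locus column is EXACTLY (L,¬P) ∧ (L,P,pure) -/

/-- THE WHOLE IMPURE PRINCIPAL COLUMN over all ground fields (display; EMPTY mod ports + lower weights:
`impurePrincipal_of_absPorts`). -/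
def ImpurePrincipalTowersTerminate (n : ℕ) : Prop :=
  NoTower n fun T => SingularClass T ∧ InLocusShadow T ∧ ∃ S : HugShadow T, S.Principal ∧ ¬ S.Pure n

/-- the impure principal column over all weights. -/
def NoImpurePrincipalTowers : Prop := ∀ n : ℕ, 1 ≤ n → ImpurePrincipalTowersTerminate n

/-- **KERNEL — THE INCOMMENSURABLE IMPURE PRINCIPAL COLUMN OVER EVERY FIELD IS EMPTY modulo the absolute port, the
coupling port and
the lower weights**: the rider law (PROVED, §32) gives a commensurable impure principal companion shadow on the
same tower, which the
coupling port re-marks at a lower weight. [folklore] -/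
theorem incommensurableImpure_of_absPorts {n : ℕ} (hRi : AbsRiderPort n) (hCo : CouplingPort n)
    (hlow : ∀ n' : ℕ, 1 ≤ n' → n' < n → ForcedTowersTerminate n') : IncommensurableImpureTowersTerminate n := by
  intro p hp k _ _ T g hB hD hE hT
  obtain ⟨hS, hL, S, hP, hnp, hi⟩ := hT
  have hcensus : RiderCensus p n S := hRi p hp k T g hB hD hE hS S (hL.2 S) hP hnp
  obtain ⟨S', hP', hnp', hc', -⟩ := hcensus.exists_commensurable_companion hp hP hi
  exact commensurableImpure_of_port hCo hlow p hp k T g hB hD hE ⟨hS, hL, S', hP', hnp', hc'⟩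

/-- **KERNEL — THE WHOLE IMPURE PRINCIPAL COLUMN (L,P,¬pure) OVER EVERY FIELD IS EMPTY modulo the two ports and
the lower weights.** [folklore] -/
theorem impurePrincipal_of_absPorts {n : ℕ} (hRi : AbsRiderPort n) (hCo : CouplingPort n)
    (hlow : ∀ n' : ℕ, 1 ≤ n' → n' < n → ForcedTowersTerminate n') : ImpurePrincipalTowersTerminate n := by
  intro p hp k _ _ T g hB hD hE hT
  obtain ⟨hS, hL, S, hP, hnp⟩ := hT
  rcases S.commensurable_or_incommensurable n with hc | hi
  · exact commensurableImpure_of_port hCo hlow p hp k T g hB hD hE ⟨hS, hL, S, hP, hnp, hc⟩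
  · exact incommensurableImpure_of_absPorts hRi hCo hlow p hp k T g hB hD hE ⟨hS, hL, S, hP, hnp, hi⟩

/-- g18's located residual (L,P,drift,wild,incomm) over every field from the two ports and the lower weights. [folklore] -/
theorem incommensurableWildDrifting_of_absPorts {n : ℕ} (hRi : AbsRiderPort n) (hCo : CouplingPort n)
    (hlow : ∀ n' : ℕ, 1 ≤ n' → n' < n → ForcedTowersTerminate n') : IncommensurableWildDriftingTowersTerminate n :=
  noTower_mono (fun _ ⟨hS, hL, S, hP, hnp, _, _, hi⟩ => ⟨hS, hL, S, hP, hnp, hi⟩) (incommensurableImpure_of_absPorts hRi hCo hlow)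

/-- **KERNEL — g19's LOCATED RESIDUAL (L,P,drift,wild,incomm · IMPERFECT k) IS DECIDED modulo the absolute port,
the coupling port and
the lower weights.** [folklore] -/
theorem incommensurableWildDriftingImperfect_of_absPorts {n : ℕ} (hRi : AbsRiderPort n) (hCo : CouplingPort n)
    (hlow : ∀ n' : ℕ, 1 ≤ n' → n' < n → ForcedTowersTerminate n') : IncommensurableWildDriftingImperfectTowersTerminate n :=
  incommensurableWildDriftingImperfect_of_g18 (incommensurableWildDrifting_of_absPorts hRi hCo hlow)

/-- **SHARP FORM — only the IMPERFECT HALF of the port is consumed by g19's residual** (the perfect half is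
g19's). [folklore] -/
theorem incommensurableWildDriftingImperfect_of_imperfectPort {n : ℕ} (hRi : ImperfectRiderPort n) (hCo : CouplingPort n)
    (hlow : ∀ n' : ℕ, 1 ≤ n' → n' < n → ForcedTowersTerminate n') : IncommensurableWildDriftingImperfectTowersTerminate n := by
  intro p hp k _ _ hk T g hB hD hE hT
  obtain ⟨hS, hL, S, hP, hnp, _, _, hi⟩ := hT
  have hcensus : RiderCensus p n S := hRi p hp k hk T g hB hD hE hS S (hL.2 S) hP hnp
  obtain ⟨S', hP', hnp', hc', -⟩ := hcensus.exists_commensurable_companion hp hP hi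
  exact commensurableImpure_of_port hCo hlow p hp k T g hB hD hE ⟨hS, hL, S', hP', hnp', hc'⟩

/-- g18's residual from g19's perfect port, the imperfect half and the coupling port (the two halves re-assembled).
[folklore] -/
theorem incommensurableWildDrifting_of_halves {n : ℕ} (hRi : RiderPort n) (hIm : ImperfectRiderPort n) (hCo : CouplingPort n)
    (hlow : ∀ n' : ℕ, 1 ≤ n' → n' < n → ForcedTowersTerminate n') : IncommensurableWildDriftingTowersTerminate n :=
  incommensurableWildDrifting_of_g19 hRi hCo hlow (incommensurableWildDriftingImperfect_of_imperfectPort hIm hCo hlow)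

/-- g17's residual (L,P,drift,wild) from the ports and the lower weights. [folklore] -/
theorem wildDrifting_of_absPorts {n : ℕ} (hRi : AbsRiderPort n) (hCo : CouplingPort n)
    (hlow : ∀ n' : ℕ, 1 ≤ n' → n' < n → ForcedTowersTerminate n') : WildDriftingTowersTerminate n :=
  wildDrifting_of_g18 hCo hlow (incommensurableWildDrifting_of_absPorts hRi hCo hlow)

/-- **THE MINIMAL-WEIGHT NORMAL FORM, g20** (modulo the COSTUME ports): below a weight at which all lower forced
towers terminate, the
in-locus column is EXACTLY `(L,¬P) ∧ (L,P,pure)` — a minimal-weight in-locus counterexample hugs a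
codimension-two surface or is PURE;
the impure principal column has been INDUCTED AWAY over every ground field. [folklore] -/
theorem inLocus_iff_residuals_of_lower_g20 {n : ℕ} (hDesc : DescentPort n) (hFC : FactorContactPort n) (hCo : CouplingPort n)
    (hRi : AbsRiderPort n) (hlow : ∀ n' : ℕ, 1 ≤ n' → n' < n → ForcedTowersTerminate n') :
    InLocusShadowTowersTerminate n ↔ NonPrincipalInLocusTowersTerminate n ∧ PurePrincipalTowersTerminate n :=
  (inLocus_iff_residuals_of_lower_g18 hDesc hFC hCo hlow).trans
    ⟨fun h => ⟨h.1, h.2.1⟩, fun h => ⟨h.1, h.2, incommensurableWildDrifting_of_absPorts hRi hCo hlow⟩⟩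

/-- **KERNEL — THE TARGET LEAF 32260 at weight `n`** from (O), (L,¬P), (L,P,pure), the six COSTUME ports and the
lower weights — NO
drifting / wild / incommensurable / imperfect residual remains. [folklore] -/
theorem singularSurface_of_g20 {n : ℕ} (hP : ShadowPort n) (hM : MarkingPort n) (hDesc : DescentPort n)
    (hFC : FactorContactPort n) (hCo : CouplingPort n) (hRi : AbsRiderPort n)
    (hlow : ∀ n' : ℕ, 1 ≤ n' → n' < n → ForcedTowersTerminate n')
    (hO : OffLocusShadowTowersTerminate n) (hNP : NonPrincipalInLocusTowersTerminate n)
    (hPu : PurePrincipalTowersTerminate n) : SingularSurfaceHuggingTowersTerminate n :=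
  singularSurface_of_g18 hP hM hDesc hFC hCo hlow hO hNP hPu (incommensurableWildDrifting_of_absPorts hRi hCo hlow)

/-- **EXACT at weight `n` below a terminating range** (ports + lower weights): 32260 at `n` ⟺ (O) ∧ (L,¬P) ∧
(L,P,pure). [folklore] -/
theorem singularSurface_iff_g20 {n : ℕ} (hP : ShadowPort n) (hM : MarkingPort n) (hDesc : DescentPort n)
    (hFC : FactorContactPort n) (hCo : CouplingPort n) (hRi : AbsRiderPort n)
    (hlow : ∀ n' : ℕ, 1 ≤ n' → n' < n → ForcedTowersTerminate n') :
    SingularSurfaceHuggingTowersTerminate n ↔ OffLocusShadowTowersTerminate n ∧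
      NonPrincipalInLocusTowersTerminate n ∧ PurePrincipalTowersTerminate n :=
  (singularSurface_iff_g18 hP hM hDesc hFC hCo hlow).trans
    ⟨fun h => ⟨h.1, h.2.1, h.2.2.1⟩, fun h => ⟨h.1, h.2.1, h.2.2, incommensurableWildDrifting_of_absPorts hRi hCo hlow⟩⟩

/-- **KERNEL — the ROOT PIECE at weight `n`** from the leaves at weight `n` and all lower weights (the step of the
strong induction; g19's
step with the imperfect residual DISCHARGED by the absolute port). [folklore] -/
theorem ftt_step_of_g20 {n : ℕ} (hn : 1 ≤ n) (hMo : MonomialCorner n) (hC : CurveLaw n) (hSL : SurfaceLaw n)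
    (hH : HypersurfaceHuggingTowersTerminate n) (hP : ShadowPort n) (hM : MarkingPort n) (hDesc : DescentPort n)
    (hFC : FactorContactPort n) (hCo : CouplingPort n) (hRi : AbsRiderPort n) (hO : OffLocusShadowTowersTerminate n)
    (hNP : NonPrincipalInLocusTowersTerminate n) (hPu : PurePrincipalTowersTerminate n)
    (hlow : ∀ n' : ℕ, 1 ≤ n' → n' < n → ForcedTowersTerminate n') : ForcedTowersTerminate n :=
  ftt_step_of_g18 hn hMo hC hSL hH hP hM hDesc hFC hCo hO hNP hPu (incommensurableWildDrifting_of_absPorts hRi hCo hlow) hlow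

/-! ## §40 (g20 · NEW) Up to the booked MaxContactCut items BY NAME — all weights (strong induction on the
weight; the impure principal
column fed back into it over every ground field) -/

/-- **THE ROOT PIECE AT EVERY WEIGHT** (strong induction on the weight). [folklore] -/
theorem forcedTowersTerminate_of_g20 (hMo : MaxContactCut.MonomialCornerAll) (hC : MaxContactCut.CurveLawAll)
    (hSL : MaxContactCut.SurfaceLawAll) (hH : MaxContactCut.NoHypersurfaceHuggingTowers) (hP : ShadowPortAll)
    (hM : MarkingPortAll) (hDesc : DescentPortAll) (hFC : FactorContactPortAll) (hCo : CouplingPortAll)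
    (hRi : AbsRiderPortAll) (hO : NoOffLocusShadowTowers) (hNP : NoNonPrincipalInLocusTowers) (hPu : NoPurePrincipalTowers) :
    ∀ n : ℕ, 1 ≤ n → ForcedTowersTerminate n := by
  intro n
  induction n using Nat.strong_induction_on with
  | _ n ih =>
    intro hn
    exact ftt_step_of_g20 hn (hMo n hn) (hC n hn) (hSL n hn) (hH n hn) (hP n hn) (hM n hn) (hDesc n hn) (hFC n hn)
      (hCo n hn) (hRi n hn) (hO n hn) (hNP n hn) (hPu n hn) fun n' h1 h2 => ih n' h2 h1

/-- **30253 `MaxContactCut.NoForcedTowers` BY NAME.** [folklore] -/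
theorem noForcedTowers_of_g20 (hMo : MaxContactCut.MonomialCornerAll) (hC : MaxContactCut.CurveLawAll)
    (hSL : MaxContactCut.SurfaceLawAll) (hH : MaxContactCut.NoHypersurfaceHuggingTowers) (hP : ShadowPortAll)
    (hM : MarkingPortAll) (hDesc : DescentPortAll) (hFC : FactorContactPortAll) (hCo : CouplingPortAll)
    (hRi : AbsRiderPortAll) (hO : NoOffLocusShadowTowers) (hNP : NoNonPrincipalInLocusTowers) (hPu : NoPurePrincipalTowers) :
    MaxContactCut.NoForcedTowers :=
  forcedTowersTerminate_of_g20 hMo hC hSL hH hP hM hDesc hFC hCo hRi hO hNP hPu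

/-- g18's residual over all weights from the ports (lower weights from the induction). [folklore] -/
theorem noIncommensurableWildDriftingTowers_of_g20 (hMo : MaxContactCut.MonomialCornerAll) (hC : MaxContactCut.CurveLawAll)
    (hSL : MaxContactCut.SurfaceLawAll) (hH : MaxContactCut.NoHypersurfaceHuggingTowers) (hP : ShadowPortAll)
    (hM : MarkingPortAll) (hDesc : DescentPortAll) (hFC : FactorContactPortAll) (hCo : CouplingPortAll)
    (hRi : AbsRiderPortAll) (hO : NoOffLocusShadowTowers) (hNP : NoNonPrincipalInLocusTowers) (hPu : NoPurePrincipalTowers) :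
    NoIncommensurableWildDriftingTowers :=
  fun n hn => incommensurableWildDrifting_of_absPorts (hRi n hn) (hCo n hn)
    fun n' h1 _ => forcedTowersTerminate_of_g20 hMo hC hSL hH hP hM hDesc hFC hCo hRi hO hNP hPu n' h1

/-- **g19's located residual over all weights DISCHARGED** from the ports (lower weights from the induction). [folklore] -/
theorem noIncommensurableWildDriftingImperfectTowers_of_g20 (hMo : MaxContactCut.MonomialCornerAll)
    (hC : MaxContactCut.CurveLawAll) (hSL : MaxContactCut.SurfaceLawAll) (hH : MaxContactCut.NoHypersurfaceHuggingTowers)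
    (hP : ShadowPortAll) (hM : MarkingPortAll) (hDesc : DescentPortAll) (hFC : FactorContactPortAll)
    (hCo : CouplingPortAll) (hRi : AbsRiderPortAll) (hO : NoOffLocusShadowTowers) (hNP : NoNonPrincipalInLocusTowers)
    (hPu : NoPurePrincipalTowers) : NoIncommensurableWildDriftingImperfectTowers :=
  fun n hn => incommensurableWildDriftingImperfect_of_absPorts (hRi n hn) (hCo n hn)
    fun n' h1 _ => forcedTowersTerminate_of_g20 hMo hC hSL hH hP hM hDesc hFC hCo hRi hO hNP hPu n' h1

/-- **the whole impure principal column over all weights DISCHARGED** from the ports. [folklore] -/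
theorem noImpurePrincipalTowers_of_g20 (hMo : MaxContactCut.MonomialCornerAll)
    (hC : MaxContactCut.CurveLawAll) (hSL : MaxContactCut.SurfaceLawAll) (hH : MaxContactCut.NoHypersurfaceHuggingTowers)
    (hP : ShadowPortAll) (hM : MarkingPortAll) (hDesc : DescentPortAll) (hFC : FactorContactPortAll)
    (hCo : CouplingPortAll) (hRi : AbsRiderPortAll) (hO : NoOffLocusShadowTowers) (hNP : NoNonPrincipalInLocusTowers)
    (hPu : NoPurePrincipalTowers) : NoImpurePrincipalTowers :=
  fun n hn => impurePrincipal_of_absPorts (hRi n hn) (hCo n hn)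
    fun n' h1 _ => forcedTowersTerminate_of_g20 hMo hC hSL hH hP hM hDesc hFC hCo hRi hO hNP hPu n' h1

/-- **THE HOST 32260 `MaxContactCut.NoSingularSurfaceHuggingTowers` BY NAME.** [folklore] -/
theorem noSingularSurfaceHuggingTowers_of_g20 (hMo : MaxContactCut.MonomialCornerAll) (hC : MaxContactCut.CurveLawAll)
    (hSL : MaxContactCut.SurfaceLawAll) (hH : MaxContactCut.NoHypersurfaceHuggingTowers) (hP : ShadowPortAll)
    (hM : MarkingPortAll) (hDesc : DescentPortAll) (hFC : FactorContactPortAll) (hCo : CouplingPortAll)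
    (hRi : AbsRiderPortAll) (hO : NoOffLocusShadowTowers) (hNP : NoNonPrincipalInLocusTowers) (hPu : NoPurePrincipalTowers) :
    MaxContactCut.NoSingularSurfaceHuggingTowers :=
  noSingularSurfaceHuggingTowers_of_g18 hMo hC hSL hH hP hM hDesc hFC hCo hO hNP hPu
    (noIncommensurableWildDriftingTowers_of_g20 hMo hC hSL hH hP hM hDesc hFC hCo hRi hO hNP hPu)

/-- 32203 `MaxContactCut.NoSurfaceHuggingTowers` BY NAME. [folklore] -/
theorem noSurfaceHuggingTowers_of_g20 (hMo : MaxContactCut.MonomialCornerAll) (hC : MaxContactCut.CurveLawAll)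
    (hSL : MaxContactCut.SurfaceLawAll) (hH : MaxContactCut.NoHypersurfaceHuggingTowers) (hP : ShadowPortAll)
    (hM : MarkingPortAll) (hDesc : DescentPortAll) (hFC : FactorContactPortAll) (hCo : CouplingPortAll)
    (hRi : AbsRiderPortAll) (hO : NoOffLocusShadowTowers) (hNP : NoNonPrincipalInLocusTowers) (hPu : NoPurePrincipalTowers) :
    MaxContactCut.NoSurfaceHuggingTowers :=
  noSurfaceHuggingTowers_of_g18 hMo hC hSL hH hP hM hDesc hFC hCo hO hNP hPu
    (noIncommensurableWildDriftingTowers_of_g20 hMo hC hSL hH hP hM hDesc hFC hCo hRi hO hNP hPu)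

/-- 31570 `MaxContactCut.NoHuggingTowers` BY NAME. [folklore] -/
theorem noHuggingTowers_of_g20 (hMo : MaxContactCut.MonomialCornerAll) (hC : MaxContactCut.CurveLawAll)
    (hSL : MaxContactCut.SurfaceLawAll) (hH : MaxContactCut.NoHypersurfaceHuggingTowers) (hP : ShadowPortAll)
    (hM : MarkingPortAll) (hDesc : DescentPortAll) (hFC : FactorContactPortAll) (hCo : CouplingPortAll)
    (hRi : AbsRiderPortAll) (hO : NoOffLocusShadowTowers) (hNP : NoNonPrincipalInLocusTowers) (hPu : NoPurePrincipalTowers) :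
    MaxContactCut.NoHuggingTowers :=
  noHuggingTowers_of_g18 hMo hC hSL hH hP hM hDesc hFC hCo hO hNP hPu
    (noIncommensurableWildDriftingTowers_of_g20 hMo hC hSL hH hP hM hDesc hFC hCo hRi hO hNP hPu)

/-- Necessity, port-free: 32260 implies the impure principal column over all weights. [folklore] -/
theorem noImpurePrincipalTowers_of_item (h : MaxContactCut.NoSingularSurfaceHuggingTowers) : NoImpurePrincipalTowers :=
  fun n hn => noTower_mono (fun _ h' => ⟨h'.1, h'.2.1⟩) (pieces_of_singularSurface_g15 (h n hn)).2.2.2.1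

/-- Necessity at weight `n`, port-free: 32260 at `n` implies the impure principal column at `n`. [folklore] -/
theorem impurePrincipal_of_singularSurface {n : ℕ} (h : SingularSurfaceHuggingTowersTerminate n) :
    ImpurePrincipalTowersTerminate n :=
  noTower_mono (fun _ h' => ⟨h'.1, h'.2.1⟩) (pieces_of_singularSurface_g15 h).2.2.2.1

/-- **EXACT AT THE ROOT 30253 modulo the decided pieces and the six COSTUME ports**:
`MaxContactCut.NoForcedTowers ⟺ (O) ∧ (L,¬P) ∧ (L,P,pure)` over all weights — the impure principal column
has been INDUCTED AWAY over
EVERY ground field. [folklore] -/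
theorem noForcedTowers_iff_g20 (hMo : MaxContactCut.MonomialCornerAll) (hC : MaxContactCut.CurveLawAll)
    (hSL : MaxContactCut.SurfaceLawAll) (hH : MaxContactCut.NoHypersurfaceHuggingTowers) (hP : ShadowPortAll)
    (hM : MarkingPortAll) (hDesc : DescentPortAll) (hFC : FactorContactPortAll) (hCo : CouplingPortAll)
    (hRi : AbsRiderPortAll) :
    MaxContactCut.NoForcedTowers ↔ NoOffLocusShadowTowers ∧ NoNonPrincipalInLocusTowers ∧ NoPurePrincipalTowers :=
  ⟨fun h => ⟨(residuals_of_noForcedTowers h).1, (residuals_of_noForcedTowers h).2.1, (residuals_of_noForcedTowers h).2.2.1⟩,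
    fun h => noForcedTowers_of_g20 hMo hC hSL hH hP hM hDesc hFC hCo hRi h.1 h.2.1 h.2.2⟩

/-- **EXACT AT THE HOST 32260 modulo the decided pieces and the ports** (through the root induction):
`MaxContactCut.NoSingularSurfaceHuggingTowers ⟺ (O) ∧ (L,¬P) ∧ (L,P,pure)`. [folklore] -/
theorem noSingularSurfaceHuggingTowers_iff_g20 (hMo : MaxContactCut.MonomialCornerAll) (hC : MaxContactCut.CurveLawAll)
    (hSL : MaxContactCut.SurfaceLawAll) (hH : MaxContactCut.NoHypersurfaceHuggingTowers) (hP : ShadowPortAll)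
    (hM : MarkingPortAll) (hDesc : DescentPortAll) (hFC : FactorContactPortAll) (hCo : CouplingPortAll)
    (hRi : AbsRiderPortAll) :
    MaxContactCut.NoSingularSurfaceHuggingTowers ↔
      NoOffLocusShadowTowers ∧ NoNonPrincipalInLocusTowers ∧ NoPurePrincipalTowers :=
  ⟨fun h => ⟨noOffLocusShadowTowers_of_item h, noNonPrincipalInLocusTowers_of_item h, noPurePrincipalTowers_of_item h⟩,
    fun h => noSingularSurfaceHuggingTowers_of_g20 hMo hC hSL hH hP hM hDesc hFC hCo hRi h.1 h.2.1 h.2.2⟩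

/-- **EXACT, the two halves displayed**: with g19's PERFECT port and the IMPERFECT half as separate hypotheses. [folklore] -/
theorem noSingularSurfaceHuggingTowers_iff_g20' (hMo : MaxContactCut.MonomialCornerAll) (hC : MaxContactCut.CurveLawAll)
    (hSL : MaxContactCut.SurfaceLawAll) (hH : MaxContactCut.NoHypersurfaceHuggingTowers) (hP : ShadowPortAll)
    (hM : MarkingPortAll) (hDesc : DescentPortAll) (hFC : FactorContactPortAll) (hCo : CouplingPortAll)
    (hRi : RiderPortAll) (hIm : ImperfectRiderPortAll) :
    MaxContactCut.NoSingularSurfaceHuggingTowers ↔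
      NoOffLocusShadowTowers ∧ NoNonPrincipalInLocusTowers ∧ NoPurePrincipalTowers :=
  noSingularSurfaceHuggingTowers_iff_g20 hMo hC hSL hH hP hM hDesc hFC hCo (absRiderPortAll_iff.mpr ⟨hRi, hIm⟩)

end Summit.ResolutionOfSingularities.ResolutionOfSingularities.Theorems.HugValuationCut
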